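import Summits.AtomisticToContinuum.Crystallization.Theorems.FrustratedLawDichotomyExemptAbsorption

/-!
# FrustratedLawDichotomy · crux `AperiodicFrustratedLawGap` (stmt-AtomisticToContinuum-27623) — «ExemptAbsorption» II: the `C_T`-free, `D_T`-free census
# object, its case split, the motif-decided exemption of record, and the record node BY NAME (decomp-a2c lens-5, g39/g40; critic rows 552, 555, 562)

Continues `…FrustratedLawDichotomyExemptAbsorption` (X ball books, bridge, exempt/tight absorption — PROVED there):

* §4 THE CENSUS OBJECT `EquilibriumMotifPricingCap ρ ϱ D W e ExM`: every injective `7/10`-separated radius-`ϱ` motif whose centre ball holds NO capped-tightly-good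
  site AND NO `ExM` site has flat book `S^D_c(0) ≥ 0` — WEAKER than `…TightFree.TightFreeMotifPricingCap` (`…_of_tightFree`; `=` it for the empty exemption,
  `equilibriumMotifPricingCap_bot_iff`; antitone in `ExM`), ★ `ballAveragedMotifPricingCapX_of_equilibrium` / `schurTopologicalPricingX_of_equilibriumMotifCap`
  (census object `⟹ SchurTopologicalPricingX … (C_T⁰ ρ) (C_T⁰ ρ) Ex`), and its CASE SPLIT `⟺ StrainedPatchMotifPricingCapX ∧ CrowdedCoreMotifPricingCap ∧
  DiluteDefectMotifPricingCap` (strained `1/8`-good patch / centre ball meets an OVER-coordinated site (relative `13/10`-shell count `≥ 13`: Z13–Z16,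
  Frank–Kasper lines) / the remaining defect balls);
* §5 the motif-decided exemption `MoveUnstableCore ε Rm s` (the `Sep`-free body of `…PairPotentialDoorXMoves.MoveUnstableLoc`): ★ `flag_moveUnstableCore_isLocal`
  (`Rm ≤ ρ₁`), `locOptFails_of_moveUnstableCore` (`1 + s ≤ Rm`, `s ≤ ϱ′`); §5b the LOCALISED REMOVAL TEST `RemovalUnstableCore eUp t Rm` (local binding within `Rm`
  alone exceeds `eUp + t + T♯(Rm)`; ★ `local_sub_tail_le_siteEnergy`: site energy `≥` local binding `− T♯(Rm)` on `7/10`-separated clusters, sharp far-field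
  constant of `…ExemptLocalSharp`), `removalUnstable_of_core`, and THE EXEMPTION OF RECORD `NonEquilibriumCore eUp ε Rm s t := MoveUnstableCore ∨ RemovalUnstableCore`
  (`ρ₁`-local; `locOptFails_of_nonEquilibriumCore`);
* §6 BY NAME: `toptFourHalf_of_equilibriumMotifCap` : `EquilibriumMotifPricingCap ρ ϱ D W₄₅ e₄₅ (NonEquilibriumCore (−0.7175) ε Rm s t) ⟹ Topt♭₄₅(ε, ϱ′, 1; C_T⁴⁵(ρ), C_T⁴⁵(ρ))`
  (`0 ≤ ρ ≤ ρ₁`, `9/2, 13/10·D + 1, Rm ≤ ρ₁`, `ρ + ρ₁ ≤ ϱ`, `1 + s ≤ Rm`, `0 ≤ s ≤ ϱ′`, `ε ≤ t`), ★★ `aperiodicFrustratedLawGap_of_equilibriumMotifCap`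
  (+ `Eopt♭₄₅`, `MuEquilibriumDoor`, `UP`), the literals of record `…_record` : `(ρ, D, ρ₁, ϱ, ε, Rm, s, t, ϱ′) = (9/5, 3/2, 7, 44/5, 1/10000, 7, 1/20, 1/10000, 3/2)`,
  the three-piece form `…_of_pieces_record`, and `equilibriumMotifPricingCap_nonEquilibrium_of_move`.

## The T-side leaf line of record (critic row 562 (4))

  `AperiodicFrustratedLawGap ⟸ MuEquilibriumDoor [PROVED] ∧ UP(−0.7175) [PROVED] ∧ Eopt♭₄₅(1e-4, 3/2, 1; C_E, D_E, D_X) [E-side]`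
  `  ∧ StrainedPatchMotifPricingCapX [WEAKER · ATTACKABLE·M] ∧ CrowdedCoreMotifPricingCap [DECLARED RESIDUAL · UNDECIDED · IDEA-NEEDED (TetrahedralFrustration)]`
  `  ∧ DiluteDefectMotifPricingCap [WEAKER · UNDECIDED]`  — at `W₄₅, e₄₅`, book radius `9/5`, motif radius `44/5`, exemption `NonEquilibriumCore (−0.7175) (1e-4) 7 (1/20) (1e-4)`.

Instrument record (cell files `decomp-a2c-lens-5/g38–g40`): book radius `3/2` is FALSE-INDICATED for the crowded-core piece (rim balls of ε-equilibrium Z13 pockets at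
`−7.0e-4`, g39 ERRATUM / rho-scan) — hence the literal `9/5` (1156 crowded-core balls, min `+5.4e-3`; whole tight-free exempt-free book 7243 balls, min `+2.79e-3`).
Why each open piece is strictly weaker than the node above it: each is implied by `…TightFree`'s corresponding `C_T`-free piece (fewer motifs qualify), none mentions
`N`, `#Ex` or the cluster; why not costume: `Topt♭₄₅ ⟸ pieces` is proved here, the converse is not claimed.  All `[folklore]` bookkeeping; 0 sorry.
-/

noncomputable section

namespace Summit.AtomisticToContinuum.Crystallization.Theorems.FrustratedLawDichotomyExemptAbsorptionRecord

open scoped BigOperators Classical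
open Literature.MathematicalPhysics.StatisticalMechanics (interactionEnergy siteEnergy lennardJones)
open Summit.AtomisticToContinuum.Crystallization.Theorems.ChargedEnergyGapNegative (E3 eStar)
open Summit.AtomisticToContinuum.Crystallization.Theorems.FrustratedLawDichotomyRangeCut
open Summit.AtomisticToContinuum.Crystallization.Theorems.FrustratedLawDichotomySchurCut
open Summit.AtomisticToContinuum.Crystallization.Theorems.FrustratedLawDichotomyLocalDischargingRule
open Summit.AtomisticToContinuum.Crystallization.Theorems.FrustratedLawDichotomyMotifLemmas
open Summit.AtomisticToContinuum.Crystallization.Theorems.FrustratedLawDichotomyMotifCount (motif_card_le)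
open Summit.AtomisticToContinuum.Crystallization.Theorems.FrustratedLawDichotomyRuleToolkit
open Summit.AtomisticToContinuum.Crystallization.Theorems.FrustratedLawDichotomyRuleToolkitGood
open Summit.AtomisticToContinuum.Crystallization.Theorems.FrustratedLawDichotomyAveragingCut
  (surplus ball ballAvg mem_ball card_ball_pos one_le_card_ball card_ball_le sum_ballAvg sum_surplus goodCount_eq_sum' BallAveragedPricing
   CutBounds Mball one_le_Mball Dfl Dfl_pos CT₀ Dfl_le_CT₀ siteEnergy_ge sum_div_ge_of_one_large W₄₅ e₄₅ CT₄₅ W₄₅_cutBounds)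
open Summit.AtomisticToContinuum.Crystallization.Theorems.FrustratedLawDichotomyAveragingRule
open Summit.AtomisticToContinuum.Crystallization.Theorems.FrustratedLawDichotomyAveragingRuleCap
open Summit.AtomisticToContinuum.Crystallization.Theorems.FrustratedLawDichotomyAveragingRuleTightFree
open Summit.AtomisticToContinuum.Crystallization.Theorems.FrustratedLawDichotomyExemptDoor (SitePred DeepAbsent)
open Summit.AtomisticToContinuum.Crystallization.Theorems.FrustratedLawDichotomyExemptLocOpt
  (LocOpt LocOptFails ExchangeUnstable locOptFails_of_exchangeUnstable)
open Summit.AtomisticToContinuum.Crystallization.Theorems.FrustratedLawDichotomyExemptSplit (SchurTopologicalPricingX SchurElasticPricingX)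
open Summit.AtomisticToContinuum.Crystallization.Theorems.FrustratedLawDichotomyOptimalityCut
  (ToptFourHalf EoptFourHalf aperiodicFrustratedLawGap_of_optimalityCut_fourHalf periodicFrustratedLawGap_of_optimalityCut_fourHalf)
open Summit.AtomisticToContinuum.Crystallization.Theorems.FrustratedLawDichotomyPairPotentialDoorXMoves
  (MoveUnstableLoc exchangeUnstable_of_moveUnstableLoc sum_local_motif injective_of_sep)
open Summit.AtomisticToContinuum.Crystallization.Theorems.FrustratedLawDichotomyExemptRemoval (RemovalUnstable removalUnstable_iff sum_eq_siteEnergy)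
open Summit.AtomisticToContinuum.Crystallization.Theorems.FrustratedLawDichotomyExemptLocalSharp (tailConstSharp tailConstSharp_nonneg abs_tsum_field_le_sharp)
open Summit.AtomisticToContinuum.Crystallization.Theorems.FrustratedLawDichotomyExemptMove (tsum_range_inter_eq_sum_filter)
open Summit.AtomisticToContinuum.Crystallization.Theorems.FrustratedLawDichotomyExemptLocal (sep_range)
open Summit.AtomisticToContinuum.Crystallization.Theorems.FrustratedLawDichotomyExemptChain (locOptFails_of_removalUnstable)
open Summit.AtomisticToContinuum.Crystallization.Theorems.FrustratedLawDichotomyExemptAbsorption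

/-! ## §4. The `C_T`-free, `D_T`-free census object and its case split -/

/-- ★ **`EquilibriumMotifPricingCap ρ ϱ D W e ExM`** — THE CENSUS OBJECT OF THE NODE: every injective `7/10`-separated motif confined to radius `ϱ` about
its centre `c` whose centre ball `B(c, ρ)` holds NO capped-tightly-good site AND NO `ExM`-site has flat book `S^D_c(0) ≥ 0` (slots `1/20, 1/8, κ_T = 1/100`).
For `ExM = MoveUnstableCore ε Rm s` these are exactly the `(ε, s)`-move-equilibrium, tight-free textures. -/
def EquilibriumMotifPricingCap (ρ ϱ D : ℝ) (W : ℝ → ℝ) (e : ℝ) (ExM : SitePred) : Prop :=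
  ∀ (M : ℕ) (z : Fin M → E3), Function.Injective z → Sep z → ∀ c : Fin M, (∀ a : Fin M, dist (z a) (z c) ≤ ϱ) →
    ¬TightNearCap ρ D z c → ¬ExemptNear ρ ExM z c → 0 ≤ ballAvg ρ z (surplusCap (1 / 20) (1 / 8) D W e (1 / 100) 0 M z) c

/-- **WEAKER**: hand-2's `TightFreeMotifPricingCap` implies the census object for every exemption. [folklore] -/
theorem equilibriumMotifPricingCap_of_tightFree {ρ ϱ D : ℝ} {W : ℝ → ℝ} {e : ℝ} (ExM : SitePred) (h : TightFreeMotifPricingCap ρ ϱ D W e) :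
    EquilibriumMotifPricingCap ρ ϱ D W e ExM :=
  fun M z hz hs c hconf ht _ => h M z hz hs c hconf ht

/-- **Sanity (empty exemption)**: with nothing exempt the census object IS `TightFreeMotifPricingCap`. [folklore] -/
theorem equilibriumMotifPricingCap_bot_iff {ρ ϱ D : ℝ} {W : ℝ → ℝ} {e : ℝ} :
    EquilibriumMotifPricingCap ρ ϱ D W e (fun _ _ _ => False) ↔ TightFreeMotifPricingCap ρ ϱ D W e :=
  ⟨fun h M z hz hs c hconf ht => h M z hz hs c hconf ht (by rintro ⟨_, _, hF⟩; exact hF),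
    fun h => equilibriumMotifPricingCap_of_tightFree _ h⟩

/-- **Sanity (degenerate exemption)**: with EVERYTHING exempt the census object is vacuous (`ρ ≥ 0`: the centre exempts its own ball) — the content of the
node lives in the IMPLICATION `ExM ⟹ Ex` to a cluster-level exemption of proved inheritance depth (§2's `hImp`), which `⊤` does not satisfy. [folklore] -/
theorem equilibriumMotifPricingCap_top {ρ ϱ D : ℝ} {W : ℝ → ℝ} {e : ℝ} (hρ : 0 ≤ ρ) :
    EquilibriumMotifPricingCap ρ ϱ D W e (fun _ _ _ => True) :=
  fun _ z _ _ c _ _ hX => (hX ⟨c, Summit.AtomisticToContinuum.Crystallization.Theorems.FrustratedLawDichotomyAveragingCut.self_mem_ball hρ z c,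
    trivial⟩).elim

/-- **Antitone in the exemption**: a LARGER motif-level exempt class gives a WEAKER census object. [folklore] -/
theorem EquilibriumMotifPricingCap.anti {ρ ϱ D : ℝ} {W : ℝ → ℝ} {e : ℝ} {ExM ExM' : SitePred} (h : EquilibriumMotifPricingCap ρ ϱ D W e ExM)
    (himp : ∀ (M : ℕ) (z : Fin M → E3) (j : Fin M), ExM M z j → ExM' M z j) : EquilibriumMotifPricingCap ρ ϱ D W e ExM' :=
  fun M z hz hs c hconf ht hX => h M z hz hs c hconf ht fun ⟨j, hj, hxj⟩ => hX ⟨j, hj, himp M z j hxj⟩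

/-- **RELATIVE FIRST-SHELL COUNT** (the engine's coordination, `g35/scripts/avgcut.py::site_class`): `#{k ≠ j : r_jk < 13/10 · r_jl for every l ≠ j}`
(= the number of atoms within `13/10 ×` the nearest-neighbour distance of `j`). -/
def shellCount {N : ℕ} (y : Fin N → E3) (j : Fin N) : ℕ :=
  (Finset.univ.filter fun k : Fin N => k ≠ j ∧ ∀ l : Fin N, l ≠ j → dist (y k) (y j) < 13 / 10 * dist (y l) (y j)).card

/-- An OVER-COORDINATED site (relative first shell of `≥ n` atoms; `n = 13`: Z13–Z16, Frank–Kasper lines) within `ρ` of `i`. -/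
def CrowdedNear (ρ : ℝ) (n : ℕ) {N : ℕ} (y : Fin N → E3) (i : Fin N) : Prop := ∃ j ∈ ball ρ y i, n ≤ shellCount y j

/-- **Piece 1 — STRAINED PATCH with the exemption** (`F1^X`): capped-tight-free, exempt-free AND capped-bad-free centre ball ⟹ `S^D_c(0) ≥ 0`.
[WEAKER than hand-2's `StrainedPatchMotifPricingCap` · ATTACKABLE·M · INSTRUMENTABLE] -/
def StrainedPatchMotifPricingCapX (ρ ϱ D : ℝ) (W : ℝ → ℝ) (e : ℝ) (ExM : SitePred) : Prop :=
  ∀ (M : ℕ) (z : Fin M → E3), Function.Injective z → Sep z → ∀ c : Fin M, (∀ a : Fin M, dist (z a) (z c) ≤ ϱ) →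
    ¬TightNearCap ρ D z c → ¬ExemptNear ρ ExM z c → ¬BadNearCap ρ D z c → 0 ≤ ballAvg ρ z (surplusCap (1 / 20) (1 / 8) D W e (1 / 100) 0 M z) c

/-- **Piece 2 — CROWDED CORE** (NEARCORE-over): capped-tight-free, exempt-free centre ball with a capped-loosely-bad site AND an over-coordinated site
(relative shell count `≥ 13`) ⟹ `S^D_c(0) ≥ 0`.  [WEAKER than `TightFreeDefectMotifPricingCap` · UNDECIDED · IDEA-NEEDED (TetrahedralFrustration; (n2)) ·
INSTRUMENTABLE (must-pass table: the Z13 pockets E01/G01/H07–H10 of the ε-equilibrium battery, all `≥ +4.6e-3` at `ρ = 3/2`)] -/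
def CrowdedCoreMotifPricingCap (ρ ϱ D : ℝ) (W : ℝ → ℝ) (e : ℝ) (ExM : SitePred) : Prop :=
  ∀ (M : ℕ) (z : Fin M → E3), Function.Injective z → Sep z → ∀ c : Fin M, (∀ a : Fin M, dist (z a) (z c) ≤ ϱ) →
    ¬TightNearCap ρ D z c → ¬ExemptNear ρ ExM z c → BadNearCap ρ D z c → CrowdedNear ρ 13 z c →
      0 ≤ ballAvg ρ z (surplusCap (1 / 20) (1 / 8) D W e (1 / 100) 0 M z) c

/-- **Piece 3 — DILUTE DEFECT** (NEARCORE-under + FARFIELD): capped-tight-free, exempt-free centre ball with a capped-loosely-bad site and NO over-coordinated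
site ⟹ `S^D_c(0) ≥ 0`.  [WEAKER than `TightFreeDefectMotifPricingCap` · UNDECIDED · INSTRUMENTABLE (vacancies, dislocation cores, faults, grain boundaries
of the battery) · ATTACKABLE·L in the far field] -/
def DiluteDefectMotifPricingCap (ρ ϱ D : ℝ) (W : ℝ → ℝ) (e : ℝ) (ExM : SitePred) : Prop :=
  ∀ (M : ℕ) (z : Fin M → E3), Function.Injective z → Sep z → ∀ c : Fin M, (∀ a : Fin M, dist (z a) (z c) ≤ ϱ) →
    ¬TightNearCap ρ D z c → ¬ExemptNear ρ ExM z c → BadNearCap ρ D z c → ¬CrowdedNear ρ 13 z c →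
      0 ≤ ballAvg ρ z (surplusCap (1 / 20) (1 / 8) D W e (1 / 100) 0 M z) c

/-- Piece 1 is WEAKER than hand-2's `F1^D`. [folklore] -/
theorem strainedPatchMotifPricingCapX_of_orig {ρ ϱ D : ℝ} {W : ℝ → ℝ} {e : ℝ} (ExM : SitePred) (h : StrainedPatchMotifPricingCap ρ ϱ D W e) :
    StrainedPatchMotifPricingCapX ρ ϱ D W e ExM :=
  fun M z hz hs c hconf ht _ hb => h M z hz hs c hconf ht hb

/-- Pieces 2 and 3 together are WEAKER than hand-2's `F2^D`. [folklore] -/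
theorem corePieces_of_orig {ρ ϱ D : ℝ} {W : ℝ → ℝ} {e : ℝ} (ExM : SitePred) (h : TightFreeDefectMotifPricingCap ρ ϱ D W e) :
    CrowdedCoreMotifPricingCap ρ ϱ D W e ExM ∧ DiluteDefectMotifPricingCap ρ ϱ D W e ExM :=
  ⟨fun M z hz hs c hconf ht _ hb _ => h M z hz hs c hconf ht hb, fun M z hz hs c hconf ht _ hb _ => h M z hz hs c hconf ht hb⟩

/-- ★ **The split is a case distinction**: `EquilibriumMotifPricingCap ⟺ F1^X ∧ CrowdedCore ∧ DiluteDefect`. [folklore] -/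
theorem equilibriumMotifPricingCap_iff_pieces {ρ ϱ D : ℝ} {W : ℝ → ℝ} {e : ℝ} {ExM : SitePred} :
    EquilibriumMotifPricingCap ρ ϱ D W e ExM ↔
      StrainedPatchMotifPricingCapX ρ ϱ D W e ExM ∧ CrowdedCoreMotifPricingCap ρ ϱ D W e ExM ∧ DiluteDefectMotifPricingCap ρ ϱ D W e ExM := by
  constructor
  · exact fun h => ⟨fun M z hz hs c hconf ht hx _ => h M z hz hs c hconf ht hx, fun M z hz hs c hconf ht hx _ _ => h M z hz hs c hconf ht hx,
      fun M z hz hs c hconf ht hx _ _ => h M z hz hs c hconf ht hx⟩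
  · rintro ⟨h1, h2, h3⟩ M z hz hs c hconf ht hx
    by_cases hb : BadNearCap ρ D z c
    · by_cases hc : CrowdedNear ρ 13 z c
      · exact h2 M z hz hs c hconf ht hx hb hc
      · exact h3 M z hz hs c hconf ht hx hb hc
    · exact h1 M z hz hs c hconf ht hx hb

/-- ★ **`C_T, D_T ≥ C_T⁰ ∧ EquilibriumMotifPricingCap ⟹ X ball book on motifs`** (any admissible instance `CutBounds W R B`, `ρ ≥ 0`). [folklore] -/
theorem ballAveragedMotifPricingCapX_of_equilibrium {W : ℝ → ℝ} {R B e ρ ϱ CT DT D : ℝ} {ExM : SitePred} (hW : CutBounds W R B) (hρ : 0 ≤ ρ)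
    (hCT : CT₀ R B e ρ ≤ CT) (hDT : CT₀ R B e ρ ≤ DT) (h : EquilibriumMotifPricingCap ρ ϱ D W e ExM) :
    BallAveragedMotifPricingCapX ρ ϱ (1 / 20) (1 / 8) D W e (1 / 100) CT DT ExM := by
  have hD : 0 ≤ Dfl R B e := (Dfl_pos hW.range_nonneg hW.floor_nonneg).le
  have hDC := Dfl_le_CT₀ (e := e) hW.range_nonneg hW.floor_nonneg ρ
  intro M z hz hs c hconf
  by_cases ht : TightNearCap ρ D z c
  · exact tightAbsorptionCapX hW hρ hCT (hD.trans (hDC.trans hDT)) hs ht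
  by_cases hx : ExemptNear ρ ExM z c
  · exact exemptAbsorptionCapX hW hρ (hD.trans (hDC.trans hCT)) hDT hs hx
  rw [ballAvg_surplusCapX_eq_of_free ht hx]
  exact h M z hz hs c hconf ht hx

/-- ★★ **`Topt♭ ⟸ EquilibriumMotifPricingCap`** for any admissible Schur cut whose `effPot` vanishes from `R′ ≤ ρ₁` on, any motif-decided `ExM` implying the
cluster-level `Ex` (`CutBounds (effPot w ω A) R B`, `0 ≤ ρ ≤ ρ₁`, `13/10·D + 1 ≤ ρ₁`, `ρ + ρ₁ ≤ ϱ`; `C_T = D_T := C_T⁰(R, B, eUp + A, ρ)`). [folklore chaining] -/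
theorem schurTopologicalPricingX_of_equilibriumMotifCap {w ω : ℝ → ℝ} {A eUp R B R' ρ ρ₁ ϱ D : ℝ} {ExM Ex : SitePred}
    (hWB : CutBounds (effPot w ω A) R B) (hW : ∀ r, R' ≤ r → effPot w ω A r = 0) (h0 : 0 ≤ ρ) (hρ : ρ ≤ ρ₁) (hR : R' ≤ ρ₁)
    (hD : 13 / 10 * D + 1 ≤ ρ₁) (hϱ : ρ + ρ₁ ≤ ϱ) (hEx : IsLocalFeature ρ₁ (flag ExM))
    (hImp : ∀ (N : ℕ) (y : Fin N → E3), Function.Injective y → Sep y → ∀ j : Fin N, ExM N y j → Ex N y j)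
    (h : EquilibriumMotifPricingCap ρ ϱ D (effPot w ω A) (eUp + A) ExM) :
    SchurTopologicalPricingX (1 / 20) (1 / 8) w ω A eUp (1 / 100) (CT₀ R B (eUp + A) ρ) (CT₀ R B (eUp + A) ρ) Ex :=
  have hC : 0 ≤ CT₀ R B (eUp + A) ρ :=
    (Dfl_pos hWB.range_nonneg hWB.floor_nonneg).le.trans (Dfl_le_CT₀ hWB.range_nonneg hWB.floor_nonneg ρ)
  schurTopologicalPricingX_of_ballAveragedMotifCapX hW (by norm_num) (by norm_num) h0 hρ hR hD hϱ hEx (by norm_num) hC hC hImp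
    (ballAveragedMotifPricingCapX_of_equilibrium hWB h0 le_rfl le_rfl h)

/-! ## §5. The motif-decided exemption of record: one-atom moves with dipole slack -/

/-- **`MoveUnstableCore ε Rm s`** — the `Sep`-free body of `…PairPotentialDoorXMoves.MoveUnstableLoc ε Rm s`: some point `p` with `dist p (y j) ≤ s`,
`dist p (y j) < 7/10` lowers the LOCAL field of `j` (atoms `k ≠ j` within `Rm` of `y_j`) by more than `ε + s·(Rm/(Rm − s))⁷·S₇♯(Rm)`.
(`MoveUnstableLoc = Sep ∧ MoveUnstableCore`; the `Sep` conjunct is dropped so that the flag is a local feature WITHOUT hypotheses.) -/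
def MoveUnstableCore (ε Rm s : ℝ) : SitePred := fun _ y j =>
  ∃ p : EuclideanSpace ℝ (Fin 3), dist p (y j) ≤ s ∧ dist p (y j) < 7 / 10 ∧
    (∑ k ∈ (Finset.univ.erase j).filter (fun k => dist (y k) (y j) ≤ Rm), lennardJones (dist p (y k))) +
        (ε + s * (Rm / (Rm - s)) ^ 7 * (6000 / 343 * Rm⁻¹ ^ 4 + 2880 / 49 * Rm⁻¹ ^ 5 + 10 / 7 * Rm⁻¹ ^ 6 + 2 * Rm⁻¹ ^ 7)) <
      ∑ k ∈ (Finset.univ.erase j).filter (fun k => dist (y k) (y j) ≤ Rm), lennardJones (dist (y j) (y k))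

/-- `MoveUnstableLoc ⟺ Sep ∧ MoveUnstableCore` (literally). [folklore] -/
theorem moveUnstableLoc_iff {ε Rm s : ℝ} {N : ℕ} {y : Fin N → E3} {j : Fin N} :
    MoveUnstableLoc ε Rm s N y j ↔ Sep y ∧ MoveUnstableCore ε Rm s N y j := Iff.rfl

/-- **The move test is MOTIF-DECIDED**: on a sub-cluster containing every atom within `ρ₁ ≥ Rm` of the site it has the same truth value. [folklore] -/
theorem moveUnstableCore_iff_motif {ε Rm s ρ₁ : ℝ} (hRm : Rm ≤ ρ₁) {N M : ℕ} {y : Fin N → E3} {φ : Fin M → Fin N} (hφ : Function.Injective φ)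
    {a : Fin M} (hS : ∀ k : Fin N, dist (y k) (y (φ a)) ≤ ρ₁ → k ∈ Set.range φ) :
    MoveUnstableCore ε Rm s M (y ∘ φ) a ↔ MoveUnstableCore ε Rm s N y (φ a) := by
  unfold MoveUnstableCore
  refine exists_congr fun p => ?_
  have e1 := sum_local_motif hRm hφ hS (fun q => lennardJones (dist p q))
  have e2 := sum_local_motif hRm hφ hS (fun q => lennardJones (dist (y (φ a)) q))
  beta_reduce at e1 e2
  simp only [Function.comp_apply] at e1 e2 ⊢
  rw [e1, e2]

/-- ★ **The flag of the move test is an `Rm`-local (hence `ρ₁`-local, `ρ₁ ≥ Rm`) site feature.** [folklore] -/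
theorem flag_moveUnstableCore_isLocal {ε Rm s ρ₁ : ℝ} (hRm : Rm ≤ ρ₁) : IsLocalFeature ρ₁ (flag (MoveUnstableCore ε Rm s)) :=
  isLocalFeature_flag_of_iff fun _ _ _ _ hφ _ hS => moveUnstableCore_iff_motif hRm hφ hS

/-- `LocOptFails` is monotone in the radius: failing `(ε, ϱ, K)`-local optimality implies failing `(ε, ϱ′, K)`-local optimality for `ϱ ≤ ϱ′`
(more competitors). [folklore] -/
theorem locOptFails_mono_radius {μ ε ϱ ϱ' : ℝ} {K : ℕ} (hle : ϱ ≤ ϱ') {N : ℕ} {y : Fin N → E3} {j : Fin N}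
    (h : LocOptFails μ ε ϱ K N y j) : LocOptFails μ ε ϱ' K N y j := by
  intro hopt
  exact h fun a s haK hs hsY hsball m R hmK hR hRball hdisj =>
    hopt a s haK hs hsY (fun l => (hsball l).trans hle) m R hmK hR (fun l => (hRball l).trans hle) hdisj

/-- ★ **The move flag certifies the cluster-level exemption of the record node**: on a `7/10`-separated cluster, `MoveUnstableCore ε Rm s` at `j`
(`1 + s ≤ Rm`, `s ≤ ϱ′`) ⟹ `¬LocOpt μ ε ϱ′ 1` at `j` for EVERY chemical potential `μ` (hand-1's dipole lemma, through
`…PairPotentialDoorXMoves.exchangeUnstable_of_moveUnstableLoc`). [folklore chaining] -/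
theorem locOptFails_of_moveUnstableCore (μ : ℝ) {ε Rm s ϱ' : ℝ} (hRm : 1 + s ≤ Rm) (hs : s ≤ ϱ') {N : ℕ} {y : Fin N → E3} (hsep : Sep y)
    {j : Fin N} (h : MoveUnstableCore ε Rm s N y j) : LocOptFails μ ε ϱ' 1 N y j :=
  locOptFails_mono_radius hs (locOptFails_of_exchangeUnstable μ (exchangeUnstable_of_moveUnstableLoc hRm ⟨hsep, h⟩))

/-! ## §5b. The removal test, localised (sharp far-field slack), and the combined exemption of record -/

/-- **`RemovalUnstableCore eUp t Rm`** — the LOCALISED removal test: the Lennard-Jones binding of `j` to the atoms within `Rm` of it ALONE exceeds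
`eUp + t + T♯(Rm)` (the atoms beyond `Rm ≥ 1` of a `7/10`-separated cluster change the site energy by at most the sharp far-field constant
`T♯(Rm)` of `…ExemptLocalSharp`; `T♯(7) ≈ 1.56e-2`).  The jammed killers U01–U05 of g35–g37 carry such sites with margin `≫ 1`. -/
def RemovalUnstableCore (eUp t Rm : ℝ) : SitePred := fun _ y j =>
  eUp + t + tailConstSharp Rm < ∑ k ∈ (Finset.univ.erase j).filter (fun k => dist (y k) (y j) ≤ Rm), lennardJones (dist (y j) (y k))

/-- The localised removal test is MOTIF-DECIDED (`Rm ≤ ρ₁`). [folklore] -/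
theorem removalUnstableCore_iff_motif {eUp t Rm ρ₁ : ℝ} (hRm : Rm ≤ ρ₁) {N M : ℕ} {y : Fin N → E3} {φ : Fin M → Fin N}
    (hφ : Function.Injective φ) {a : Fin M} (hS : ∀ k : Fin N, dist (y k) (y (φ a)) ≤ ρ₁ → k ∈ Set.range φ) :
    RemovalUnstableCore eUp t Rm M (y ∘ φ) a ↔ RemovalUnstableCore eUp t Rm N y (φ a) := by
  unfold RemovalUnstableCore
  have e2 := sum_local_motif hRm hφ hS (fun q => lennardJones (dist (y (φ a)) q))
  beta_reduce at e2
  simp only [Function.comp_apply] at e2 ⊢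
  rw [e2]

/-- ★ The flag of the localised removal test is `ρ₁`-local (`Rm ≤ ρ₁`). [folklore] -/
theorem flag_removalUnstableCore_isLocal {eUp t Rm ρ₁ : ℝ} (hRm : Rm ≤ ρ₁) : IsLocalFeature ρ₁ (flag (RemovalUnstableCore eUp t Rm)) :=
  isLocalFeature_flag_of_iff fun _ _ _ _ hφ _ hS => removalUnstableCore_iff_motif hRm hφ hS

/-- **Site energy ≥ local binding − T♯(Rm)** on a `7/10`-separated cluster (`Rm ≥ 1`): the far atoms form a `7/10`-separated set beyond distance `Rm`.
[folklore] -/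
theorem local_sub_tail_le_siteEnergy {Rm : ℝ} (hRm : 1 ≤ Rm) {N : ℕ} {y : Fin N → E3} (hsep : Sep y) (j : Fin N) :
    (∑ k ∈ (Finset.univ.erase j).filter (fun k => dist (y k) (y j) ≤ Rm), lennardJones (dist (y j) (y k))) - tailConstSharp Rm ≤
      siteEnergy lennardJones y j := by
  classical
  have hy := injective_of_sep hsep
  have h1 : siteEnergy lennardJones y j = ∑ k ∈ Finset.univ.erase j, lennardJones (dist (y j) (y k)) := by
    rw [← sum_eq_siteEnergy, ← Finset.add_sum_erase Finset.univ _ (Finset.mem_univ j), dist_self,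
      Literature.MathematicalPhysics.StatisticalMechanics.lennardJones_zero, zero_add]
  have h2 := Finset.sum_filter_add_sum_filter_not (Finset.univ.erase j) (fun k => dist (y k) (y j) ≤ Rm)
    (fun k => lennardJones (dist (y j) (y k)))
  set T : Set E3 := {q | ¬dist q (y j) ≤ Rm} with hT
  have h3 : ∑ k ∈ (Finset.univ.erase j).filter (fun k => ¬dist (y k) (y j) ≤ Rm), lennardJones (dist (y j) (y k)) =
      ∑' q : ↥(Set.range y ∩ T), lennardJones (dist (y j) q) := by
    rw [tsum_range_inter_eq_sum_filter hy T (fun q => lennardJones (dist (y j) q))]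
    refine Finset.sum_congr ?_ fun _ _ => rfl
    ext k
    simp only [Finset.mem_filter, Finset.mem_erase, Finset.mem_univ, true_and, and_true, hT, Set.mem_setOf_eq]
    constructor
    · exact fun h => h.2
    · intro h
      refine ⟨?_, h⟩
      rintro rfl
      exact h (by rw [dist_self]; linarith)
  have hsepY : ∀ a ∈ Set.range y ∩ T, ∀ b ∈ Set.range y ∩ T, a ≠ b → (7 : ℝ) / 10 ≤ dist a b :=
    fun a ha b hb hab => sep_range hsep a ha.1 b hb.1 hab
  have hfar : ∀ q ∈ Set.range y ∩ T, Rm ≤ dist (y j) q := fun q hq => by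
    have h := hq.2
    simp only [hT, Set.mem_setOf_eq, not_le] at h
    rw [dist_comm]; exact h.le
  have h4 := abs_tsum_field_le_sharp hsepY (y j) hRm hfar
  have h5 := neg_abs_le (∑' q : ↥(Set.range y ∩ T), lennardJones (dist (y j) q))
  rw [h1, ← h2, h3]
  linarith

/-- ★ **The localised removal test certifies the tree's `RemovalUnstable`** (`Rm ≥ 1`, `7/10`-separated cluster). [folklore] -/
theorem removalUnstable_of_core {eUp t Rm : ℝ} (hRm : 1 ≤ Rm) {N : ℕ} {y : Fin N → E3} (hsep : Sep y) {j : Fin N}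
    (h : RemovalUnstableCore eUp t Rm N y j) : RemovalUnstable eUp t N y j := by
  rw [removalUnstable_iff]
  unfold RemovalUnstableCore at h
  have h' := local_sub_tail_le_siteEnergy hRm hsep j
  linarith

/-- ★ … hence `¬LocOpt e⋆ ε ϱ′ 1` (`e⋆ ≤ eUp`, `ε ≤ t`, `0 ≤ ϱ′`, `Rm ≥ 1`; `…ExemptChain.locOptFails_of_removalUnstable`: delete the atom). [folklore chaining] -/
theorem locOptFails_of_removalUnstableCore {eUp t ε ϱ' Rm : ℝ} (hUp : eStar ≤ eUp) (hεt : ε ≤ t) (hϱ : 0 ≤ ϱ') (hRm : 1 ≤ Rm) {N : ℕ}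
    {y : Fin N → E3} (hsep : Sep y) {j : Fin N} (h : RemovalUnstableCore eUp t Rm N y j) : LocOptFails eStar ε ϱ' 1 N y j :=
  locOptFails_of_removalUnstable hUp hεt hϱ le_rfl (injective_of_sep hsep) (removalUnstable_of_core hRm hsep h)

/-- ★ **`NonEquilibriumCore eUp ε Rm s t`** — THE MOTIF-DECIDED EXEMPTION OF RECORD: a one-atom move of step `≤ s` gains `> ε` (+ dipole slack) OR
deleting the atom gains `> t` (+ sharp tail slack), both read off the atoms within `Rm`. -/
def NonEquilibriumCore (eUp ε Rm s t : ℝ) : SitePred := fun N y j => MoveUnstableCore ε Rm s N y j ∨ RemovalUnstableCore eUp t Rm N y j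

/-- ★ Its flag is `ρ₁`-local (`Rm ≤ ρ₁`). [folklore] -/
theorem flag_nonEquilibriumCore_isLocal {eUp ε Rm s t ρ₁ : ℝ} (hRm : Rm ≤ ρ₁) : IsLocalFeature ρ₁ (flag (NonEquilibriumCore eUp ε Rm s t)) :=
  isLocalFeature_flag_of_iff fun _ _ _ _ hφ _ hS => or_congr (moveUnstableCore_iff_motif hRm hφ hS) (removalUnstableCore_iff_motif hRm hφ hS)

/-- ★ **It certifies the cluster-level exemption of the record node**: `Sep ∧ NonEquilibriumCore eUp ε Rm s t ⟹ ¬LocOpt e⋆ ε ϱ′ 1`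
(`e⋆ ≤ eUp`, `1 + s ≤ Rm`, `0 ≤ s ≤ ϱ′`, `ε ≤ t`). [folklore chaining] -/
theorem locOptFails_of_nonEquilibriumCore {eUp ε Rm s t ϱ' : ℝ} (hUp : eStar ≤ eUp) (hRm1 : 1 + s ≤ Rm) (hs0 : 0 ≤ s) (hs : s ≤ ϱ') (hεt : ε ≤ t)
    {N : ℕ} {y : Fin N → E3} (hsep : Sep y) {j : Fin N} (h : NonEquilibriumCore eUp ε Rm s t N y j) : LocOptFails eStar ε ϱ' 1 N y j :=
  h.elim (fun hm => locOptFails_of_moveUnstableCore eStar hRm1 hs hsep hm)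
    fun hr => locOptFails_of_removalUnstableCore hUp hεt (hs0.trans hs) (by linarith) hsep hr

/-- The census object at the combined exemption is WEAKER than at the move exemption alone (antitonicity). [folklore] -/
theorem equilibriumMotifPricingCap_nonEquilibrium_of_move {ρ ϱ D : ℝ} {W : ℝ → ℝ} {e eUp ε Rm s t : ℝ}
    (h : EquilibriumMotifPricingCap ρ ϱ D W e (MoveUnstableCore ε Rm s)) : EquilibriumMotifPricingCap ρ ϱ D W e (NonEquilibriumCore eUp ε Rm s t) :=
  h.anti fun _ _ _ hm => Or.inl hm

/-! ## §6. The record node BY NAME -/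

/-- ★★ **`Topt♭₄₅(ε, ϱ′, 1; C_T⁴⁵(ρ), C_T⁴⁵(ρ)) ⟸ EquilibriumMotifPricingCap ρ ϱ D W₄₅ e₄₅ (NonEquilibriumCore (−0.7175) ε Rm s t)`**
(`e⋆ ≤ −0.7175`, `0 ≤ ρ ≤ ρ₁`, `9/2 ≤ ρ₁`, `13/10·D + 1 ≤ ρ₁`, `Rm ≤ ρ₁`, `ρ + ρ₁ ≤ ϱ`, `1 + s ≤ Rm`, `0 ≤ s ≤ ϱ′`, `ε ≤ t`). [folklore chaining] -/
theorem toptFourHalf_of_equilibriumMotifCap {ρ ρ₁ ϱ D ε Rm s t ϱ' : ℝ} (hUp : eStar ≤ -(7175 / 10000)) (h0 : 0 ≤ ρ) (hρ : ρ ≤ ρ₁) (hR : 9 / 2 ≤ ρ₁)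
    (hD : 13 / 10 * D + 1 ≤ ρ₁) (hRm : Rm ≤ ρ₁) (hϱ : ρ + ρ₁ ≤ ϱ) (hRm1 : 1 + s ≤ Rm) (hs0 : 0 ≤ s) (hs : s ≤ ϱ') (hεt : ε ≤ t)
    (h : EquilibriumMotifPricingCap ρ ϱ D (effPot w₄₅ ω₄ (3 / 400)) (-(7175 / 10000) + 3 / 400) (NonEquilibriumCore (-(7175 / 10000)) ε Rm s t)) :
    ToptFourHalf ε ϱ' 1 (CT₄₅ ρ) (CT₄₅ ρ) :=
  schurTopologicalPricingX_of_equilibriumMotifCap W₄₅_cutBounds (fun _ hr => effPot_fourHalf_eq_zero _ hr) h0 hρ hR hD hϱ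
    (flag_nonEquilibriumCore_isLocal hRm) (fun _ _ _ hsep _ hx => locOptFails_of_nonEquilibriumCore hUp hRm1 hs0 hs hεt hsep hx) h

/-- ★★★ **THE NODE «ExemptAbsorption»: the crux `AperiodicFrustratedLawGap` (item 27623) BY NAME** from `MuEquilibriumDoor ∧ UP(−0.7175) ∧ Eopt♭₄₅(ε, ϱ′, 1; C_E, D_E, D_X)`
and the `C_T`-free, `D_T`-free census object at the combined exemption (side conditions of `toptFourHalf_of_equilibriumMotifCap`, `0 < ε`, `0 ≤ D_X`;
`e⋆ ≤ −0.7175` is read off `UP`). [folklore chaining] -/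
theorem aperiodicFrustratedLawGap_of_equilibriumMotifCap {ρ ρ₁ ϱ D ε Rm s t ϱ' CE DE DX : ℝ}
    (hDoor : Summit.AtomisticToContinuum.Crystallization.Theses.GrainCoreNetworkSplit.MuEquilibriumDoor)
    (hU : PeriodicEnergyCeiling (-(7175 / 10000))) (hε : 0 < ε) (hDX : 0 ≤ DX) (hE : EoptFourHalf ε ϱ' 1 CE DE DX)
    (h0 : 0 ≤ ρ) (hρ : ρ ≤ ρ₁) (hR : 9 / 2 ≤ ρ₁) (hD : 13 / 10 * D + 1 ≤ ρ₁) (hRm : Rm ≤ ρ₁) (hϱ : ρ + ρ₁ ≤ ϱ) (hRm1 : 1 + s ≤ Rm) (hs0 : 0 ≤ s)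
    (hs : s ≤ ϱ') (hεt : ε ≤ t)
    (h : EquilibriumMotifPricingCap ρ ϱ D (effPot w₄₅ ω₄ (3 / 400)) (-(7175 / 10000) + 3 / 400) (NonEquilibriumCore (-(7175 / 10000)) ε Rm s t)) :
    Summit.AtomisticToContinuum.Crystallization.Theses.FrustratedLawDichotomy.AperiodicFrustratedLawGap :=
  have hC : 0 ≤ CT₄₅ ρ :=
    (Dfl_pos W₄₅_cutBounds.range_nonneg W₄₅_cutBounds.floor_nonneg).le.trans
      (Dfl_le_CT₀ W₄₅_cutBounds.range_nonneg W₄₅_cutBounds.floor_nonneg ρ)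
  aperiodicFrustratedLawGap_of_optimalityCut_fourHalf hDoor hU hε hC hDX
    (toptFourHalf_of_equilibriumMotifCap (eStar_le_of_periodicEnergyCeiling hU) h0 hρ hR hD hRm hϱ hRm1 hs0 hs hεt h) hE

/-- The sibling item 27624 `PeriodicFrustratedLawGap` from the same node. [folklore chaining] -/
theorem periodicFrustratedLawGap_of_equilibriumMotifCap {ρ ρ₁ ϱ D ε Rm s t ϱ' CE DE DX : ℝ}
    (hDoor : Summit.AtomisticToContinuum.Crystallization.Theses.GrainCoreNetworkSplit.MuEquilibriumDoor)
    (hU : PeriodicEnergyCeiling (-(7175 / 10000))) (hε : 0 < ε) (hDX : 0 ≤ DX) (hE : EoptFourHalf ε ϱ' 1 CE DE DX)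
    (h0 : 0 ≤ ρ) (hρ : ρ ≤ ρ₁) (hR : 9 / 2 ≤ ρ₁) (hD : 13 / 10 * D + 1 ≤ ρ₁) (hRm : Rm ≤ ρ₁) (hϱ : ρ + ρ₁ ≤ ϱ) (hRm1 : 1 + s ≤ Rm) (hs0 : 0 ≤ s)
    (hs : s ≤ ϱ') (hεt : ε ≤ t)
    (h : EquilibriumMotifPricingCap ρ ϱ D (effPot w₄₅ ω₄ (3 / 400)) (-(7175 / 10000) + 3 / 400) (NonEquilibriumCore (-(7175 / 10000)) ε Rm s t)) :
    Summit.AtomisticToContinuum.Crystallization.Theses.FrustratedLawDichotomy.PeriodicFrustratedLawGap :=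
  have hC : 0 ≤ CT₄₅ ρ :=
    (Dfl_pos W₄₅_cutBounds.range_nonneg W₄₅_cutBounds.floor_nonneg).le.trans
      (Dfl_le_CT₀ W₄₅_cutBounds.range_nonneg W₄₅_cutBounds.floor_nonneg ρ)
  periodicFrustratedLawGap_of_optimalityCut_fourHalf hDoor hU hε hC hDX
    (toptFourHalf_of_equilibriumMotifCap (eStar_le_of_periodicEnergyCeiling hU) h0 hρ hR hD hRm hϱ hRm1 hs0 hs hεt h) hE

/-- ★ **THE LITERAL OF RECORD** `(ρ, D, ρ₁, ϱ, ε, Rm, s, t, ϱ′) = (RHO, 3/2, 7, RHO + 7, 1/10000, 7, 1/20, 1/10000, 3/2)` (`ε_opt = 1e-4`, critic row 555 (B)(2); `t = ε`) with the book radius `RHO := 9 / 5`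
(g39 must-pass table: the smallest radius of the scan {23/20, 3/2, 9/5, 21/10} at which every tight-free exempt-free ball of the 104 ε-equilibria is `≥ +1e-3`;
at `3/2` the rim balls of the equilibrium Z13 pocket sit at `−7.0e-4`) — numeric side conditions discharged. [folklore chaining] -/
theorem aperiodicFrustratedLawGap_of_equilibriumMotifCap_record {CE DE DX : ℝ}
    (hDoor : Summit.AtomisticToContinuum.Crystallization.Theses.GrainCoreNetworkSplit.MuEquilibriumDoor)
    (hU : PeriodicEnergyCeiling (-(7175 / 10000))) (hDX : 0 ≤ DX) (hE : EoptFourHalf (1 / 10000) (3 / 2) 1 CE DE DX)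
    (h : EquilibriumMotifPricingCap (9 / 5) (44 / 5) (3 / 2) (effPot w₄₅ ω₄ (3 / 400)) (-(7175 / 10000) + 3 / 400)
      (NonEquilibriumCore (-(7175 / 10000)) (1 / 10000) 7 (1 / 20) (1 / 10000))) :
    Summit.AtomisticToContinuum.Crystallization.Theses.FrustratedLawDichotomy.AperiodicFrustratedLawGap :=
  aperiodicFrustratedLawGap_of_equilibriumMotifCap (ρ₁ := 7) hDoor hU (by norm_num) hDX hE (by norm_num) (by norm_num) (by norm_num) (by norm_num)
    le_rfl (by norm_num) (by norm_num) (by norm_num) (by norm_num) le_rfl h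

/-- ★ **THE NODE IN THREE PIECES at the literal of record**: `MuEquilibriumDoor ∧ UP(−0.7175) ∧ Eopt♭₄₅(1/10000, 3/2, 1; …) ∧ F1^X ∧ CrowdedCore ∧ DiluteDefect ⟹`
crux. [folklore chaining] -/
theorem aperiodicFrustratedLawGap_of_pieces_record {CE DE DX : ℝ}
    (hDoor : Summit.AtomisticToContinuum.Crystallization.Theses.GrainCoreNetworkSplit.MuEquilibriumDoor)
    (hU : PeriodicEnergyCeiling (-(7175 / 10000))) (hDX : 0 ≤ DX) (hE : EoptFourHalf (1 / 10000) (3 / 2) 1 CE DE DX)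
    (h1 : StrainedPatchMotifPricingCapX (9 / 5) (44 / 5) (3 / 2) (effPot w₄₅ ω₄ (3 / 400)) (-(7175 / 10000) + 3 / 400)
      (NonEquilibriumCore (-(7175 / 10000)) (1 / 10000) 7 (1 / 20) (1 / 10000)))
    (h2 : CrowdedCoreMotifPricingCap (9 / 5) (44 / 5) (3 / 2) (effPot w₄₅ ω₄ (3 / 400)) (-(7175 / 10000) + 3 / 400)
      (NonEquilibriumCore (-(7175 / 10000)) (1 / 10000) 7 (1 / 20) (1 / 10000)))
    (h3 : DiluteDefectMotifPricingCap (9 / 5) (44 / 5) (3 / 2) (effPot w₄₅ ω₄ (3 / 400)) (-(7175 / 10000) + 3 / 400)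
      (NonEquilibriumCore (-(7175 / 10000)) (1 / 10000) 7 (1 / 20) (1 / 10000))) :
    Summit.AtomisticToContinuum.Crystallization.Theses.FrustratedLawDichotomy.AperiodicFrustratedLawGap :=
  aperiodicFrustratedLawGap_of_equilibriumMotifCap_record hDoor hU hDX hE (equilibriumMotifPricingCap_iff_pieces.2 ⟨h1, h2, h3⟩)

/-- **No regression**: hand-2's `C_T`-free object still closes the crux THROUGH this node at the literal of record (with `Eopt♭₄₅`). [folklore chaining] -/
example {CE DE DX : ℝ}
    (hDoor : Summit.AtomisticToContinuum.Crystallization.Theses.GrainCoreNetworkSplit.MuEquilibriumDoor)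
    (hU : PeriodicEnergyCeiling (-(7175 / 10000))) (hDX : 0 ≤ DX) (hE : EoptFourHalf (1 / 10000) (3 / 2) 1 CE DE DX)
    (h : TightFreeMotifPricingCap (9 / 5) (44 / 5) (3 / 2) (effPot w₄₅ ω₄ (3 / 400)) (-(7175 / 10000) + 3 / 400)) :
    Summit.AtomisticToContinuum.Crystallization.Theses.FrustratedLawDichotomy.AperiodicFrustratedLawGap :=
  aperiodicFrustratedLawGap_of_equilibriumMotifCap_record hDoor hU hDX hE (equilibriumMotifPricingCap_of_tightFree _ h)

end Summit.AtomisticToContinuum.Crystallization.Theorems.FrustratedLawDichotomyExemptAbsorptionRecord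

end
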